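import Literature.Computability.AlgebraicComplexity.LR17ExteriorDetReprProofs
import Literature.Computability.AlgebraicComplexity.LR17EquivariantRepresentationsProofs
import Literature.LinearAlgebra.Matrix.SylvesterFranke
import HarnessLib

/-!
# LR17 Prop. 2.16 — the exterior-algebra representation of `det_m` respects `GL(E)`;
# discharge of `lr_prop_2_16`

Topic `Literature/Computability/AlgebraicComplexity`. Companion (proofs only; no definitions, no
named facts) of `LR17EquivariantRepresentations.lean` (the named fact `lr_prop_2_16` and the matrix
`LR17.detHalfMatrix k m` on `LR17.HalfIdx m = {S ⊊ [m]}`) and of `LR17ExteriorDetReprProofs.lean`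
(its first conjunct: `Ã` is a regular determinantal representation of `detHalfSign m · det_m`).
Here the SECOND conjunct is proved — `Ã` admits exact `GL_n × GL_n` lifts of the left
multiplications `g ⊗ 1`, `g ∈ GL_m` (the tree's `leftLinearSubst k m`, LR's `GL(E)`) — and the fact
is discharged: `lr_prop_2_16_holds : lr_prop_2_16`. Consequently Thm. 2.14's "Moreover" half holds
unconditionally (`LR17.hasRegularEquivariantDetRepr_detPoly`, from `lr_thm_2_14_le`).

## The printed proof (arXiv:1508.05788 §4.1, p0012:L38–L63) and how it is followed
Landsberg–Ressayre: "To analyze the action of `GL(E)` on `Ã`, reinterpret `ℂ^{n*} ⊗ ℂⁿ` without the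
identification `Λ⁰E ≃ ΛᵐE` as `(⊕_{j=0}^{m-1} ΛʲE)^* ⊗ (⊕_{i=1}^{m} ΛⁱE)` … Using the maps (uwk)
[`ex_k(v)(ω) = v ∧ ω`], we get `GL(E)`-equivariant maps … Hence for all `u ∈ E ⊗ F*` and all
`g ∈ GL(E)`, `Det(ã(g⁻¹u)) = (g · Det)(ã(u)) = det(g)⁻¹ Det(ã(u))`. Equation (3) shows that `GL(E)`
is contained in the image of `ρ̄_A`."  In coordinates (the basis `e_S`, `S ⊆ [m]`, of `⊕_j ΛʲE`;
`∧ʲg` has the matrix of `j × j` minors of `g`) this is the statement that the wedge matrix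
`W(v)_{S∪{i},S} = ε(S,i) vᵢ` of `ex(v)` intertwines the compound matrices:
**`W(Gv) · M(G) = M(G) · W(v)`**, `M(G)_{X,Y} = det G_{X,Y}` (`|X| = |Y|`) — proved here
(`wedge_mul_minor`) by the Laplace expansion of a `(j+1) × (j+1)` minor along the new column, the
Koszul signs `ε(U∖i, i)`, `ε(S, j)` being exactly the cofactor signs of the increasing enumerations
(`sum_koszulSign_mul_minor_erase`; a repeated column gives `0`).  The substitution `y ↦ (g ⊗ 1) · y`
of the tree (`linSubst`: `X_{(i,c)} ↦ Σ_j g_{ji} X_{(j,c)}`) multiplies every column vector `yᶜ` by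
`G = gᵀ` (`linSubst_kronecker_one_wt`).  Writing `Ã = [E (1 + N(y))]_{≠ univ}` — `N(y)` the arc
matrix of the whole subset lattice, `E` the identity with the row of `∅` replaced by the row of
`univ` (the identification `ΛᵐE ≃ Λ⁰E`), `[·]_{≠ univ}` the block of the proper subsets
(`halfShape_eq_block`) — one gets `N(Gy) M = M N(y)` (`arcs_mul_minor`), `E M = (M D) E` with
`D = diag(det G at ∅, 1 elsewhere)` (`wrapRow_mul_minor`: the merged vertex receives `∧ᵐ gᵀ = det g`
on its incoming side and `∧⁰ = 1` on its outgoing side), hence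
`E(1 + N(Gy)) M = (M D) E (1 + N(y))` and, the blocks of `M`, `M D` against `univ` being zero,
**`Ã(γ·y) · Q = P · Ã(y)`** with `Q = [M(gᵀ)]_{≠ univ} = ⊕_{j<m} ∧ʲgᵀ` and `P = Q · D`
(`block_wrapArcs_mul_minor`).  `Q` is invertible with inverse `[M((g⁻¹)ᵀ)]_{≠ univ}` by the
Cauchy–Binet formula, imported from the tree's compound-matrix file
(`Literature.LinearAlgebra.Matrix.compound_mul`, `compound_one`; here `minor_mul_minor`), so
`Ã(γ·y) = P Ã(y) Q⁻¹` with `P, Q ∈ GL_n(k)` after transport along any `e : HalfIdx m ≃ Fin n`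
(`exists_lift_generator`), and `IsEquivariantDetRepr.of_generators` extends the lifts from the
generators `g ⊗ 1` to the subgroup `leftLinearSubst k m` they generate.  DEVIATION from print: none in
content; the paper's invariant-theoretic sentence "we get `GL(E)`-equivariant maps" is unfolded into
the explicit matrix identity above, and the scalar `det(g)⁻¹` of equation (3) is the `∅`-entry of `D`
(our lifts act by `P = Q D` on rows, `Q` on columns; `det P / det Q = det g`).
Honest framing (cell `val-lit`): a discharge of printed content; nothing here bears on `VP ≠ VNP`
beyond what Landsberg–Ressayre print.

## Main statements
* `LR17.isEquivariantDetRepr_detHalfMatrix` — for every field `k`, `m ≥ 1`, `e : HalfIdx m ≃ Fin n`: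
  `IsEquivariantDetRepr (leftLinearSubst k m) (C (detHalfSign m) * detPoly (Fin m) k) (reindex e e Ã)`;
* `lr_prop_2_16_holds : lr_prop_2_16` — **the discharge** (both conjuncts, over `ℂ`);
* `LR17.hasRegularEquivariantDetRepr_detPoly` — Thm. 2.14, "Moreover" half, unconditionally:
  `HasRegularEquivariantDetRepr (leftLinearSubst ℂ m) (detPoly (Fin m) ℂ) (2^m - 1)` (`m ≥ 1`).

## References
* [LandsbergRessayre2017] J. M. Landsberg, N. Ressayre, *Permanent v. determinant: an exponential
  lower bound assuming symmetry and a potential path towards Valiant's conjecture*, Differential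
  Geom. Appl. 55 (2017) 146–166, arXiv:1508.05788, Prop. 2.16 (p0007:L22–L40), §4.1 (p0012:L38–L63).
* [Bernstein2009] D. S. Bernstein, *Matrix Mathematics*, 2nd ed. (2009), Fact 7.5.17 (vi) (the
  Binet–Cauchy theorem for compound matrices; the tree's `Literature/LinearAlgebra/Matrix/SylvesterFranke.lean`).
-/

noncomputable section

open Matrix MvPolynomial Finset
open scoped Kronecker

namespace Literature.Computability.AlgebraicComplexity

namespace LR17

/-! ### Increasing enumerations of finite sets of indices -/

section Enumeration

variable {m : ℕ}

/-- The `a`-th element (in increasing order) of `U` has exactly `a` elements of `U` below it.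
[folklore] -/
private theorem card_filter_lt_orderEmbOfFin {U : Finset (Fin m)} {r : ℕ} (hU : U.card = r)
    (a : Fin r) : (U.filter (· < U.orderEmbOfFin hU a)).card = a := by
  have key : U.filter (· < U.orderEmbOfFin hU a) = (Finset.Iio a).image (U.orderEmbOfFin hU) := by
    ext x
    simp only [Finset.mem_filter, Finset.mem_image, Finset.mem_Iio]
    constructor
    · rintro ⟨hx, hlt⟩
      have hx' : x ∈ Set.range (U.orderEmbOfFin hU) := by
        rw [Finset.range_orderEmbOfFin]
        exact hx
      obtain ⟨b, rfl⟩ := hx'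
      exact ⟨b, (U.orderEmbOfFin hU).lt_iff_lt.mp hlt, rfl⟩
    · rintro ⟨b, hb, rfl⟩
      exact ⟨Finset.orderEmbOfFin_mem U hU b, (U.orderEmbOfFin hU).lt_iff_lt.mpr hb⟩
  rw [key, Finset.card_image_of_injective _ (U.orderEmbOfFin hU).injective, Fin.card_Iio]

/-- Deleting the `a`-th element: the increasing enumeration of `U` composed with `a.succAbove` is
the increasing enumeration of `U ∖ {a-th element}` (stated for any `S'` with the right members).
[folklore] -/
private theorem orderEmbOfFin_comp_succAbove {U S' : Finset (Fin m)} {r : ℕ} (hU : U.card = r + 1)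
    (hS' : S'.card = r) (a : Fin (r + 1))
    (hmem : ∀ x, x ∈ S' ↔ x ∈ U ∧ x ≠ U.orderEmbOfFin hU a) :
    (fun x => U.orderEmbOfFin hU (a.succAbove x)) = S'.orderEmbOfFin hS' := by
  refine Finset.orderEmbOfFin_unique hS' (fun x => ?_) ?_
  · rw [hmem]
    exact ⟨Finset.orderEmbOfFin_mem U hU _,
      fun h => Fin.succAbove_ne a x ((U.orderEmbOfFin hU).injective h)⟩
  · exact (U.orderEmbOfFin hU).strictMono.comp (Fin.strictMono_succAbove a)

end Enumeration

/-! ### Minors: Laplace expansion against a Koszul-signed column, Cauchy–Binet -/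

section Minors

variable {m : ℕ} {R : Type*} [CommRing R]

/-- Reading a minor `det G_{X,Y}` through any pair of cardinality proofs. [folklore] -/
private theorem minor_eq {G : Matrix (Fin m) (Fin m) R} {M : Matrix (Finset (Fin m)) (Finset (Fin m)) R}
    (hM : ∀ X Y, M X Y = if h : X.card = Y.card then
      (G.submatrix (X.orderEmbOfFin rfl) (Y.orderEmbOfFin h.symm)).det else 0)
    {X Y : Finset (Fin m)} {r : ℕ} (hX : X.card = r) (hY : Y.card = r) :
    M X Y = (G.submatrix (X.orderEmbOfFin hX) (Y.orderEmbOfFin hY)).det := by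
  rw [hM, dif_pos (hX.trans hY.symm)]
  subst hX
  rfl

/-- **Laplace expansion of the minors against one column, with Koszul signs**: for every `U, S`
and every column index `j`,
`Σ_{i ∈ U} ε(U∖i, i) G_{ij} det G_{U∖i, S} = ε(S, j) det G_{U, S ∪ j}` if `j ∉ S`, and `= 0` if
`j ∈ S` (a determinant with a repeated column); both sides vanish unless `|U| = |S| + 1`.
[folklore] -/
private theorem sum_koszulSign_mul_minor_erase {G : Matrix (Fin m) (Fin m) R}
    {M : Matrix (Finset (Fin m)) (Finset (Fin m)) R}
    (hM : ∀ X Y, M X Y = if h : X.card = Y.card then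
      (G.submatrix (X.orderEmbOfFin rfl) (Y.orderEmbOfFin h.symm)).det else 0)
    (U S : Finset (Fin m)) (j : Fin m) :
    (∑ i ∈ U, (koszulSign (U.erase i) i : R) * G i j * M (U.erase i) S) =
      if j ∉ S then (koszulSign S j : R) * M U (insert j S) else 0 := by
  classical
  by_cases hcard : U.card = S.card + 1
  swap
  · have h1 : ∀ i ∈ U, M (U.erase i) S = 0 := fun i hi => by
      have hpos : 0 < U.card := Finset.card_pos.mpr ⟨i, hi⟩
      have hne : (U.erase i).card ≠ S.card := by
        rw [Finset.card_erase_of_mem hi]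
        omega
      rw [hM, dif_neg hne]
    rw [Finset.sum_eq_zero fun i hi => by rw [h1 i hi, mul_zero]]
    split_ifs with hj
    · rfl
    · have hne : U.card ≠ (insert j S).card := by
        rw [Finset.card_insert_of_notMem hj]
        exact hcard
      rw [hM, dif_neg hne, mul_zero]
  set r := S.card with hr
  -- the sum over `U`, read through the increasing enumeration of `U`
  have hsum : (∑ i ∈ U, (koszulSign (U.erase i) i : R) * G i j * M (U.erase i) S) =
      ∑ a : Fin (r + 1), (-1 : R) ^ (a : ℕ) * G (U.orderEmbOfFin hcard a) j *
        (G.submatrix (fun x => U.orderEmbOfFin hcard (a.succAbove x)) (S.orderEmbOfFin rfl)).det := by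
    have hmap := Finset.sum_map Finset.univ (U.orderEmbOfFin hcard).toEmbedding
      (fun i => (koszulSign (U.erase i) i : R) * G i j * M (U.erase i) S)
    rw [Finset.map_orderEmbOfFin_univ] at hmap
    rw [hmap]
    refine Finset.sum_congr rfl fun a _ => ?_
    have hi := Finset.orderEmbOfFin_mem U hcard a
    have hUe : (U.erase (U.orderEmbOfFin hcard a)).card = r := by
      rw [Finset.card_erase_of_mem hi, hcard, Nat.add_sub_cancel]
    rw [RelEmbedding.coe_toEmbedding, minor_eq hM hUe rfl,
      ← orderEmbOfFin_comp_succAbove hcard hUe a (fun x => Finset.mem_erase.trans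
        ⟨fun h => ⟨h.2, h.1⟩, fun h => ⟨h.2, h.1⟩⟩)]
    congr 2
    unfold koszulSign
    rw [Finset.filter_erase, Finset.erase_eq_of_notMem (by simp),
      card_filter_lt_orderEmbOfFin hcard a]
    push_cast
    rfl
  rw [hsum]
  by_cases hj : j ∈ S
  · -- a determinant with two equal columns
    rw [if_neg (not_not.mpr hj)]
    obtain ⟨b₀, hb₀⟩ : j ∈ Set.range (S.orderEmbOfFin rfl) := by
      rw [Finset.range_orderEmbOfFin]
      exact hj
    set N' : Matrix (Fin (r + 1)) (Fin (r + 1)) R :=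
      G.submatrix (U.orderEmbOfFin hcard) (Fin.cons j (S.orderEmbOfFin rfl)) with hN'
    have hdet : N'.det = 0 := by
      refine Matrix.det_zero_of_column_eq (Fin.succ_ne_zero b₀).symm fun a => ?_
      simp only [hN', Matrix.submatrix_apply, Fin.cons_zero, Fin.cons_succ, hb₀]
    rw [Matrix.det_succ_column N' 0] at hdet
    rw [← hdet]
    refine Finset.sum_congr rfl fun a _ => ?_
    simp only [hN', Matrix.submatrix_apply, Matrix.submatrix_submatrix, Fin.cons_zero,
      Fin.val_zero, add_zero, Fin.succAbove_zero]
    rfl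
  · rw [if_pos hj]
    have hSj : (insert j S).card = r + 1 := by rw [Finset.card_insert_of_notMem hj]
    rw [minor_eq hM hcard hSj]
    obtain ⟨p, hp⟩ : j ∈ Set.range ((insert j S).orderEmbOfFin hSj) := by
      rw [Finset.range_orderEmbOfFin]
      exact Finset.mem_insert_self j S
    have hpS : (fun x => (insert j S).orderEmbOfFin hSj (p.succAbove x)) = S.orderEmbOfFin rfl :=
      orderEmbOfFin_comp_succAbove hSj rfl p fun x => by
        rw [hp, Finset.mem_insert]
        constructor
        · intro hx
          exact ⟨Or.inr hx, fun h => hj (h ▸ hx)⟩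
        · rintro ⟨hx | hx, hne⟩
          · exact absurd hx hne
          · exact hx
    have hκ : (koszulSign S j : R) = (-1) ^ (p : ℕ) := by
      unfold koszulSign
      rw [← card_filter_lt_orderEmbOfFin hSj p, hp, Finset.filter_insert, if_neg (lt_irrefl j)]
      push_cast
      rfl
    rw [hκ, Matrix.det_succ_column _ p, Finset.mul_sum]
    refine Finset.sum_congr rfl fun a _ => ?_
    simp only [Matrix.submatrix_apply, Matrix.submatrix_submatrix, hp]
    have hp2 : ((-1 : R) ^ (p : ℕ)) * (-1) ^ (p : ℕ) = 1 := by
      rw [← pow_add, ← two_mul, pow_mul, neg_one_sq, one_pow]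
    rw [show (fun x => ((insert j S).orderEmbOfFin hSj) (p.succAbove x)) =
        ⇑((insert j S).orderEmbOfFin hSj) ∘ p.succAbove from rfl] at hpS
    rw [hpS, pow_add]
    simp only [Function.comp_def]
    linear_combination (-((-1 : R) ^ (a : ℕ) * G (U.orderEmbOfFin hcard a) j *
      (G.submatrix (fun x => U.orderEmbOfFin hcard (a.succAbove x)) ⇑(S.orderEmbOfFin rfl)).det)) *
      hp2

/-- **The wedge intertwining** `ex(Gv) ∘ Λ(G) = Λ(G) ∘ ex(v)`: for the Koszul-signed wedge matrix
`W(v)_{U,S} = ε(S,i) v_i` (`U = S ∪ {i}`) and the block-diagonal matrix of minors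
`M_{X,Y} = det G_{X,Y}` (`|X| = |Y|`), `W(Gv) M = M W(v)` — the matrix form of
`(∧^{j+1} G)(v ∧ ω) = (Gv) ∧ (∧^j G)(ω)`. [folklore] -/
private theorem wedge_mul_minor {G : Matrix (Fin m) (Fin m) R}
    {M : Matrix (Finset (Fin m)) (Finset (Fin m)) R}
    (hM : ∀ X Y, M X Y = if h : X.card = Y.card then
      (G.submatrix (X.orderEmbOfFin rfl) (Y.orderEmbOfFin h.symm)).det else 0)
    (v : Fin m → R) {W Wg : Matrix (Finset (Fin m)) (Finset (Fin m)) R}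
    (hW : ∀ U S, W U S = ∑ i, if i ∉ S ∧ U = insert i S then (koszulSign S i : R) * v i else 0)
    (hWg : ∀ U S, Wg U S =
      ∑ i, if i ∉ S ∧ U = insert i S then (koszulSign S i : R) * G.mulVec v i else 0) :
    Wg * M = M * W := by
  classical
  ext U S
  rw [Matrix.mul_apply, Matrix.mul_apply]
  -- collapse the inner sums: the only `S'` with `U = S' ∪ {i}` is `U.erase i`
  have hcollapse : ∀ (f : Finset (Fin m) → Fin m → R) (i : Fin m),
      (∑ S', (if i ∉ S' ∧ U = insert i S' then f S' i else 0) * M S' S) =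
        if i ∈ U then f (U.erase i) i * M (U.erase i) S else 0 := by
    intro f i
    rw [Finset.sum_eq_single (U.erase i)]
    · by_cases hi : i ∈ U
      · rw [if_pos ⟨Finset.notMem_erase i U, (Finset.insert_erase hi).symm⟩, if_pos hi]
      · rw [if_neg, if_neg hi, zero_mul]
        rintro ⟨-, h⟩
        exact hi (h ▸ Finset.mem_insert_self i _)
    · intro S' _ hS'
      rw [if_neg, zero_mul]
      rintro ⟨hi, rfl⟩
      exact hS' (Finset.erase_insert hi).symm
    · intro h
      exact absurd (Finset.mem_univ _) h
  have hL : (∑ S', Wg U S' * M S' S) =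
      ∑ j, (∑ i ∈ U, (koszulSign (U.erase i) i : R) * G i j * M (U.erase i) S) * v j := by
    simp_rw [hWg, Finset.sum_mul]
    rw [Finset.sum_comm]
    simp_rw [hcollapse (fun S' i => (koszulSign S' i : R) * G.mulVec v i), ← Finset.sum_filter,
      Finset.filter_mem_eq_inter, Finset.univ_inter, Matrix.mulVec, dotProduct, Finset.mul_sum,
      Finset.sum_mul]
    rw [Finset.sum_comm]
    refine Finset.sum_congr rfl fun j _ => Finset.sum_congr rfl fun i _ => ?_
    ring
  have hR : (∑ T', M U T' * W T' S) =
      ∑ j, (if j ∉ S then (koszulSign S j : R) * M U (insert j S) else 0) * v j := by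
    simp_rw [hW, Finset.mul_sum]
    rw [Finset.sum_comm]
    refine Finset.sum_congr rfl fun j _ => ?_
    rw [Finset.sum_eq_single (insert j S)]
    · by_cases hj : j ∈ S
      · simp [hj]
      · simp [hj]
        ring
    · intro T' _ hT'
      rw [if_neg, mul_zero]
      rintro ⟨-, rfl⟩
      exact hT' rfl
    · intro h
      exact absurd (Finset.mem_univ _) h
  rw [hL, hR]
  refine Finset.sum_congr rfl fun j _ => ?_
  rw [sum_koszulSign_mul_minor_erase hM U S j]

/-- **Cauchy–Binet for the block matrix of minors**: `M(G) M(H) = M(GH)` (the tree's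
`compound_mul`, Bernstein Fact 7.5.17 (vi), block by block). [folklore] -/
private theorem minor_mul_minor {G H : Matrix (Fin m) (Fin m) R}
    {MG MH MGH : Matrix (Finset (Fin m)) (Finset (Fin m)) R}
    (hMG : ∀ X Y, MG X Y = if h : X.card = Y.card then
      (G.submatrix (X.orderEmbOfFin rfl) (Y.orderEmbOfFin h.symm)).det else 0)
    (hMH : ∀ X Y, MH X Y = if h : X.card = Y.card then
      (H.submatrix (X.orderEmbOfFin rfl) (Y.orderEmbOfFin h.symm)).det else 0)
    (hMGH : ∀ X Y, MGH X Y = if h : X.card = Y.card then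
      ((G * H).submatrix (X.orderEmbOfFin rfl) (Y.orderEmbOfFin h.symm)).det else 0) :
    MG * MH = MGH := by
  classical
  ext X Z
  rw [Matrix.mul_apply]
  by_cases hXZ : X.card = Z.card
  swap
  · rw [hMGH, dif_neg hXZ]
    refine Finset.sum_eq_zero fun Y _ => ?_
    by_cases hXY : X.card = Y.card
    · rw [hMH, dif_neg (fun h => hXZ (hXY.trans h)), mul_zero]
    · rw [hMG, dif_neg hXY, zero_mul]
  set r := X.card with hr
  -- pass to the compound matrices of the tree (`Literature.LinearAlgebra.Matrix.compound`)
  have hcomp : ∀ (A : Matrix (Fin m) (Fin m) R) {X' Y' : Finset (Fin m)} (hX' : X'.card = r)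
      (hY' : Y'.card = r),
      (A.submatrix (X'.orderEmbOfFin hX') (Y'.orderEmbOfFin hY')).det =
        Literature.LinearAlgebra.Matrix.compound r A (Set.powersetCard.ofCard hX')
          (Set.powersetCard.ofCard hY') := fun A X' Y' hX' hY' => rfl
  have hsum : (∑ Y, MG X Y * MH Y Z) =
      ∑ Y : Set.powersetCard (Fin m) r,
        Literature.LinearAlgebra.Matrix.compound r G (Set.powersetCard.ofCard rfl) Y *
          Literature.LinearAlgebra.Matrix.compound r H Y (Set.powersetCard.ofCard hXZ.symm) := by
    have hterm : ∀ Y : Finset (Fin m), MG X Y * MH Y Z =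
        if hY : Y.card = r then
          Literature.LinearAlgebra.Matrix.compound r G (Set.powersetCard.ofCard rfl)
              (Set.powersetCard.ofCard hY) *
            Literature.LinearAlgebra.Matrix.compound r H (Set.powersetCard.ofCard hY)
              (Set.powersetCard.ofCard hXZ.symm) else 0 := by
      intro Y
      by_cases hY : Y.card = r
      · rw [dif_pos hY, minor_eq hMG rfl hY, minor_eq hMH hY hXZ.symm, hcomp, hcomp]
      · rw [dif_neg hY, hMG, dif_neg (fun h => hY h.symm), zero_mul]
    simp_rw [hterm]
    rw [← Finset.sum_filter_of_ne (s := Finset.univ) (p := fun Y : Finset (Fin m) => Y.card = r)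
        (fun Y _ hY => by
          by_contra h
          exact hY (dif_neg h)),
      Finset.sum_subtype (univ.filter fun Y : Finset (Fin m) => Y.card = r)
        (p := fun Y : Finset (Fin m) => Y ∈ Set.powersetCard (Fin m) r)
        (fun Y => by simp [Set.powersetCard.mem_iff])]
    refine Finset.sum_congr rfl fun Y _ => ?_
    rw [dif_pos (Set.powersetCard.mem_iff.mp Y.2)]
    rfl
  rw [hsum, ← Matrix.mul_apply, ← Literature.LinearAlgebra.Matrix.compound_mul, hMGH, dif_pos hXZ]
  rfl

end Minors

/-! ### The subset lattice: arcs, minors, the wrap row operation, block extraction -/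

section Lattice

variable {m : ℕ} {R : Type*} [CommRing R]

/-- Off-level minors vanish. [folklore] -/
private theorem minor_of_card_ne {G : Matrix (Fin m) (Fin m) R}
    {M : Matrix (Finset (Fin m)) (Finset (Fin m)) R}
    (hM : ∀ X Y, M X Y = if h : X.card = Y.card then
      (G.submatrix (X.orderEmbOfFin rfl) (Y.orderEmbOfFin h.symm)).det else 0)
    {X Y : Finset (Fin m)} (h : X.card ≠ Y.card) : M X Y = 0 := by
  rw [hM, dif_neg h]

/-- The empty minor is `1`. [folklore] -/
private theorem minor_empty_empty {G : Matrix (Fin m) (Fin m) R}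
    {M : Matrix (Finset (Fin m)) (Finset (Fin m)) R}
    (hM : ∀ X Y, M X Y = if h : X.card = Y.card then
      (G.submatrix (X.orderEmbOfFin rfl) (Y.orderEmbOfFin h.symm)).det else 0) :
    M ∅ ∅ = 1 := by
  rw [minor_eq hM (Finset.card_empty) (Finset.card_empty)]
  exact Matrix.det_fin_zero

/-- The full minor is `det G`. [folklore] -/
private theorem minor_univ_univ {G : Matrix (Fin m) (Fin m) R}
    {M : Matrix (Finset (Fin m)) (Finset (Fin m)) R}
    (hM : ∀ X Y, M X Y = if h : X.card = Y.card then
      (G.submatrix (X.orderEmbOfFin rfl) (Y.orderEmbOfFin h.symm)).det else 0) :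
    M univ univ = G.det := by
  rw [minor_eq hM (Finset.card_fin m) (Finset.card_fin m)]
  have hid : (fun x => x) = ⇑((univ : Finset (Fin m)).orderEmbOfFin (Finset.card_fin m)) :=
    Finset.orderEmbOfFin_unique _ (fun x => Finset.mem_univ _) strictMono_id
  rw [← hid]
  exact congrArg Matrix.det (Matrix.submatrix_id_id G)

/-- **Step 1 (all levels at once).** For the arc matrix `N(y)` of the subset lattice (arc
`S → S ∪ {i}` carrying `ε(S,i) yⁱ_{|S|}`) and its substituted version `N(Gy)`:
`N(Gy) M = M N(y)`. [folklore] -/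
private theorem arcs_mul_minor {G : Matrix (Fin m) (Fin m) R}
    {M N Ng : Matrix (Finset (Fin m)) (Finset (Fin m)) R}
    (hM : ∀ X Y, M X Y = if h : X.card = Y.card then
      (G.submatrix (X.orderEmbOfFin rfl) (Y.orderEmbOfFin h.symm)).det else 0)
    (f : Fin m → ℕ → R)
    (hN : ∀ U S, N U S = ∑ i, if i ∉ S ∧ U = insert i S then (koszulSign S i : R) * f i S.card else 0)
    (hNg : ∀ U S, Ng U S = ∑ i, if i ∉ S ∧ U = insert i S then
      (koszulSign S i : R) * G.mulVec (fun j => f j S.card) i else 0) :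
    Ng * M = M * N := by
  classical
  ext U S
  set W : Matrix (Finset (Fin m)) (Finset (Fin m)) R := Matrix.of fun U' S' =>
    ∑ i, if i ∉ S' ∧ U' = insert i S' then (koszulSign S' i : R) * f i S.card else 0 with hWdef
  set Wg : Matrix (Finset (Fin m)) (Finset (Fin m)) R := Matrix.of fun U' S' =>
    ∑ i, if i ∉ S' ∧ U' = insert i S' then
      (koszulSign S' i : R) * G.mulVec (fun j => f j S.card) i else 0 with hWgdef
  have key := wedge_mul_minor hM (fun j => f j S.card) (W := W) (Wg := Wg) (fun _ _ => rfl)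
    (fun _ _ => rfl)
  have hL : (Ng * M) U S = (Wg * M) U S := by
    rw [Matrix.mul_apply, Matrix.mul_apply]
    refine Finset.sum_congr rfl fun S' _ => ?_
    by_cases hc : S'.card = S.card
    · rw [hNg, hWgdef, Matrix.of_apply, hc]
    · rw [minor_of_card_ne hM hc, mul_zero, mul_zero]
  have hR : (M * N) U S = (M * W) U S := by
    rw [Matrix.mul_apply, Matrix.mul_apply]
    refine Finset.sum_congr rfl fun T' _ => ?_
    rw [hN, hWdef, Matrix.of_apply]
  rw [hL, hR, key]

/-- **Step 2 (the wrap `Λ^mE ≃ Λ^0E` as a row operation).** With `E` the identity matrix whose row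
`∅` is replaced by the unit row at `univ`, and `D = diag(det G at ∅, 1 elsewhere)`:
`E M = (M D) E` (`m ≥ 1`). [folklore] -/
private theorem wrapRow_mul_minor (hm : 1 ≤ m) {G : Matrix (Fin m) (Fin m) R}
    {M E D : Matrix (Finset (Fin m)) (Finset (Fin m)) R}
    (hM : ∀ X Y, M X Y = if h : X.card = Y.card then
      (G.submatrix (X.orderEmbOfFin rfl) (Y.orderEmbOfFin h.symm)).det else 0)
    (hE : ∀ U S, E U S = if U = ∅ then (if S = univ then 1 else 0) else (if U = S then 1 else 0))
    (hD : D = Matrix.diagonal fun S => if S = ∅ then G.det else 1) :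
    E * M = M * D * E := by
  classical
  have hne : (∅ : Finset (Fin m)) ≠ univ := by
    haveI : Nonempty (Fin m) := ⟨⟨0, hm⟩⟩
    exact Finset.univ_nonempty.ne_empty.symm
  ext U S
  have hL : (E * M) U S = if U = ∅ then M univ S else M U S := by
    rw [Matrix.mul_apply]
    simp_rw [hE]
    split_ifs with hU <;> simp [Finset.sum_ite_eq', Finset.sum_ite_eq]
  have hR : (M * D * E) U S =
      M U ∅ * G.det * (if S = univ then 1 else 0) + (if S = ∅ then 0 else M U S) := by
    rw [Matrix.mul_apply]
    have hterm : ∀ V, (M * D) U V * E V S =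
        (if V = ∅ then M U ∅ * G.det * (if S = univ then 1 else 0) else 0) +
          (if V = S then (if S = ∅ then 0 else M U S) else 0) := by
      intro V
      rw [hD, Matrix.mul_diagonal, hE]
      by_cases hV : V = ∅
      · subst hV
        by_cases hS : S = ∅
        · subst hS
          simp [hne]
        · simp [Ne.symm hS]
      · by_cases hVS : V = S
        · subst hVS
          simp [hV]
        · simp [hV, hVS]
    simp_rw [hterm]
    rw [Finset.sum_add_distrib, Finset.sum_ite_eq', Finset.sum_ite_eq']
    simp
  rw [hL, hR]
  by_cases hU : U = ∅
  · subst hU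
    rw [if_pos rfl, minor_empty_empty hM, one_mul]
    by_cases hS : S = univ
    · subst hS
      rw [if_pos rfl, mul_one, if_neg (Ne.symm hne), minor_univ_univ hM,
        minor_of_card_ne hM (by rw [Finset.card_empty, Finset.card_fin]; omega), add_zero]
    · rw [if_neg hS, mul_zero, zero_add, minor_of_card_ne hM (fun h => hS ?_)]
      · split_ifs with hS0
        · rfl
        · rw [minor_of_card_ne hM]
          rw [Finset.card_empty]
          exact fun h => hS0 (Finset.card_eq_zero.mp h.symm)
      · exact Finset.eq_univ_of_card _ (by rw [← h, Finset.card_univ])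
  · rw [if_neg hU, minor_of_card_ne hM (Y := ∅) (by
      rw [Finset.card_empty]; exact fun h => hU (Finset.card_eq_zero.mp h)), zero_mul, zero_mul,
      zero_add]
    split_ifs with hS0
    · subst hS0
      exact minor_of_card_ne hM (by
        rw [Finset.card_empty]; exact fun h => hU (Finset.card_eq_zero.mp h))
    · rfl

/-- **Step 3.** `E (1 + N(Gy)) M = (M D) (E (1 + N(y)))`. [folklore] -/
private theorem wrapArcs_mul_minor {M N Ng E D : Matrix (Finset (Fin m)) (Finset (Fin m)) R}
    (h1 : Ng * M = M * N) (h2 : E * M = M * D * E) :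
    E * (1 + Ng) * M = M * D * (E * (1 + N)) := by
  have h3 : M + M * N = M * (1 + N) := by rw [Matrix.mul_add, Matrix.mul_one]
  rw [Matrix.mul_assoc, Matrix.add_mul, Matrix.one_mul, h1, h3, ← Matrix.mul_assoc, h2,
    Matrix.mul_assoc]

/-- **Step 4 (block extraction).** Deleting the row and column of `univ`: the off-diagonal blocks
of `M` and `M D` against `univ` vanish, so the identity of Step 3 restricts to the
`(≠ univ)`-blocks. [folklore] -/
private theorem block_wrapArcs_mul_minor {G : Matrix (Fin m) (Fin m) R}
    {M N Ng E D : Matrix (Finset (Fin m)) (Finset (Fin m)) R}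
    (hM : ∀ X Y, M X Y = if h : X.card = Y.card then
      (G.submatrix (X.orderEmbOfFin rfl) (Y.orderEmbOfFin h.symm)).det else 0)
    (hD : D = Matrix.diagonal fun S => if S = ∅ then G.det else 1)
    (h : E * (1 + Ng) * M = M * D * (E * (1 + N))) :
    (E * (1 + Ng)).toSquareBlockProp (fun S => S ≠ univ) * M.toSquareBlockProp (fun S => S ≠ univ) =
      (M * D).toSquareBlockProp (fun S => S ≠ univ) *
        (E * (1 + N)).toSquareBlockProp (fun S => S ≠ univ) := by
  classical
  have hcard : ∀ {T : Finset (Fin m)}, T ≠ univ → T.card ≠ (univ : Finset (Fin m)).card :=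
    fun hT h => hT (Finset.eq_univ_of_card _ (by rw [h, Finset.card_univ]))
  have hoff₁ : M.toBlock (fun S => ¬(S ≠ univ)) (fun S => S ≠ univ) = 0 := by
    ext ⟨T, hT⟩ ⟨S, hS⟩
    rw [not_ne_iff] at hT
    subst hT
    rw [Matrix.toBlock_apply, Matrix.zero_apply]
    exact minor_of_card_ne hM (Ne.symm (hcard hS))
  have hoff₂ : (M * D).toBlock (fun S => S ≠ univ) (fun S => ¬(S ≠ univ)) = 0 := by
    ext ⟨T, hT⟩ ⟨S, hS⟩
    rw [not_ne_iff] at hS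
    subst hS
    rw [Matrix.toBlock_apply, Matrix.zero_apply, hD, Matrix.mul_diagonal, minor_of_card_ne hM (hcard hT),
      zero_mul]
  have key := congrArg (fun X => Matrix.toBlock X (fun S : Finset (Fin m) => S ≠ univ)
    (fun S : Finset (Fin m) => S ≠ univ)) h
  have e1 := Matrix.toBlock_mul_eq_add (fun S : Finset (Fin m) => S ≠ univ) (fun S => S ≠ univ)
    (fun S => S ≠ univ) (E * (1 + Ng)) M
  have e2 := Matrix.toBlock_mul_eq_add (fun S : Finset (Fin m) => S ≠ univ) (fun S => S ≠ univ)
    (fun S => S ≠ univ) (M * D) (E * (1 + N))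
  rw [hoff₁, Matrix.mul_zero, add_zero] at e1
  rw [hoff₂, Matrix.zero_mul, add_zero] at e2
  change (E * (1 + Ng)).toBlock (fun S => S ≠ univ) (fun S => S ≠ univ) *
      M.toBlock (fun S => S ≠ univ) (fun S => S ≠ univ) =
    (M * D).toBlock (fun S => S ≠ univ) (fun S => S ≠ univ) *
      (E * (1 + N)).toBlock (fun S => S ≠ univ) (fun S => S ≠ univ)
  rw [← e1, ← e2, key]

end Lattice

/-! ### Prop. 2.16's matrix as the `(≠ univ)`-block of `E (1 + N(y))` -/

section Shape

variable {m : ℕ} {R : Type*} [CommRing R]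

/-- A matrix on `HalfIdx m` with Prop. 2.16's shape (diagonal `1` at levels `≥ 1`, arc entries
`ε(S,i) fⁱ_{|S|}` in row `wrap (S ∪ {i})`, column `S`) is the `(≠ univ)`-block of `E (1 + N)`, where
`N` is the arc matrix of the subset lattice with the same arc entries and `E` replaces the row of
`∅` by the row of `univ` (the wrap `Λ^mE ≃ Λ^0E`). [folklore] -/
private theorem halfShape_eq_block {f : Fin m → ℕ → R} {B : Matrix (HalfIdx m) (HalfIdx m) R}
    {N E : Matrix (Finset (Fin m)) (Finset (Fin m)) R}
    (hB : ∀ T S, B T S = (if T = S ∧ S.1.Nonempty then 1 else 0) +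
      ∑ i, if i ∉ S.1 ∧ T.1 = wrap m (insert i S.1) then (koszulSign S.1 i : R) * f i S.1.card else 0)
    (hN : ∀ U S, N U S = ∑ i, if i ∉ S ∧ U = insert i S then (koszulSign S i : R) * f i S.card else 0)
    (hE : ∀ U S, E U S = if U = ∅ then (if S = univ then 1 else 0) else (if U = S then 1 else 0)) :
    B = (E * (1 + N)).toSquareBlockProp fun S => S ≠ univ := by
  classical
  refine Matrix.ext fun T S => ?_
  rw [Matrix.toSquareBlockProp_def, Matrix.of_apply, Matrix.mul_apply, hB]
  have hEsum : ∀ X : Finset (Fin m) → R,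
      (∑ V, E T.1 V * X V) = if T.1 = ∅ then X univ else X T.1 := by
    intro X
    simp_rw [hE]
    split_ifs with hT <;> simp [Finset.sum_ite_eq, Finset.sum_ite_eq']
  rw [hEsum fun V => (1 + N) V S.1]
  by_cases hT : T.1 = ∅
  · rw [if_pos hT, Matrix.add_apply, Matrix.one_apply, hN,
      if_neg (show ¬((univ : Finset (Fin m)) = S.1) from fun h => S.2 h.symm), zero_add]
    have h1 : ¬(T = S ∧ S.1.Nonempty) := by
      rintro ⟨rfl, hS⟩
      exact hS.ne_empty hT
    rw [if_neg h1, zero_add]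
    refine Finset.sum_congr rfl fun i _ => ?_
    have hiff : (T.1 = wrap m (insert i S.1)) ↔ (univ = insert i S.1) := by
      rw [hT]
      unfold wrap
      split_ifs with h
      · exact ⟨fun _ => h.symm, fun _ => rfl⟩
      · exact ⟨fun h' => absurd h'.symm (Finset.insert_ne_empty i S.1),
          fun h' => absurd h'.symm h⟩
    simp only [hiff]
  · rw [if_neg hT, Matrix.add_apply, Matrix.one_apply, hN]
    congr 1
    · have hiff : (T = S ∧ S.1.Nonempty) ↔ T.1 = S.1 := by
        constructor
        · rintro ⟨rfl, -⟩
          rfl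
        · intro h
          exact ⟨Subtype.ext h, Finset.nonempty_iff_ne_empty.mpr (h ▸ hT)⟩
      simp only [hiff]
    · refine Finset.sum_congr rfl fun i _ => ?_
      have hiff : (T.1 = wrap m (insert i S.1)) ↔ (T.1 = insert i S.1) := by
        unfold wrap
        split_ifs with h
        · exact ⟨fun h' => absurd h' hT, fun h' => absurd (h'.trans h) T.2⟩
        · exact Iff.rfl
      simp only [hiff]

end Shape

/-! ### The substitution `g ⊗ 1` on Prop. 2.16's matrix -/

section Subst

variable {k : Type*} [CommRing k] {m : ℕ}

/-- Left multiplication `y ↦ g ⊗ 1 · y` on the variables of Grenet's weights: the column vector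
`(yʲ_c)_j` is multiplied by `gᵀ`. [folklore] -/
private theorem linSubst_kronecker_one_wt (g : Matrix (Fin m) (Fin m) k) (i : Fin m) (c : ℕ) :
    linSubst (Fin m × Fin m) k (g ⊗ₖ (1 : Matrix (Fin m) (Fin m) k)) (Grenet.wt k m i c) =
      ((Matrix.transpose g).map (C : k →+* MvPolynomial (Fin m × Fin m) k)).mulVec (fun j => Grenet.wt k m j c) i := by
  classical
  unfold Grenet.wt
  split_ifs with hc
  · rw [linSubst_X, Matrix.mulVec, dotProduct, Fintype.sum_prod_type]
    refine Finset.sum_congr rfl fun j _ => ?_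
    simp_rw [Matrix.kronecker_apply, Matrix.one_apply, mul_ite, mul_one, mul_zero, ite_smul,
      zero_smul, Finset.sum_ite_eq', Finset.mem_univ, if_true]
    rw [Matrix.map_apply, Matrix.transpose_apply, MvPolynomial.smul_eq_C_mul]
  · simp [Matrix.mulVec, dotProduct]

/-- The entries of `Ã(g ⊗ 1 · y)`: Prop. 2.16's shape with the arc vectors `yᶜ` replaced by
`gᵀ yᶜ`. [folklore] -/
private theorem linSubstEntries_detHalfMatrix_apply {γ : GL (Fin m × Fin m) k} {g : Matrix (Fin m) (Fin m) k}
    (hγ : (γ : Matrix (Fin m × Fin m) (Fin m × Fin m) k) = g ⊗ₖ (1 : Matrix (Fin m) (Fin m) k))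
    (T S : HalfIdx m) :
    Matrix.linSubstEntries γ (detHalfMatrix k m) T S =
      (if T = S ∧ S.1.Nonempty then 1 else 0) +
        ∑ i, if i ∉ S.1 ∧ T.1 = wrap m (insert i S.1) then
          (koszulSign S.1 i : MvPolynomial (Fin m × Fin m) k) *
            ((Matrix.transpose g).map (C : k →+* MvPolynomial (Fin m × Fin m) k)).mulVec
              (fun j => Grenet.wt k m j S.1.card) i else 0 := by
  rw [Matrix.linSubstEntries, Matrix.map_apply, hγ, detHalfMatrix, Matrix.of_apply, map_add, map_sum]
  congr 1
  · split_ifs <;> simp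
  · refine Finset.sum_congr rfl fun i _ => ?_
    split_ifs
    · rw [map_mul, linSubst_C, linSubst_kronecker_one_wt, map_intCast]
    · exact map_zero _

/-- The entries of `Ã(y)` itself in the same normal form (integer Koszul signs cast into the
polynomial ring). [folklore] -/
private theorem detHalfMatrix_apply' (T S : HalfIdx m) :
    detHalfMatrix k m T S =
      (if T = S ∧ S.1.Nonempty then 1 else 0) +
        ∑ i, if i ∉ S.1 ∧ T.1 = wrap m (insert i S.1) then
          (koszulSign S.1 i : MvPolynomial (Fin m × Fin m) k) * Grenet.wt k m i S.1.card else 0 := by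
  rw [detHalfMatrix, Matrix.of_apply]
  simp_rw [map_intCast]

end Subst

/-! ### The exact `GL(E)`-lifts and the discharge of `lr_prop_2_16` -/

section Equivariance

variable {k : Type*} [Field k] {m : ℕ}

/-- Block extraction for a product whose second factor has a vanishing lower-left block.
[folklore] -/
private theorem toSquareBlockProp_mul_of_lowerLeft {ι : Type*} [Fintype ι] {R : Type*} [CommRing R]
    (p : ι → Prop) [DecidablePred p] (A B : Matrix ι ι R) (h : B.toBlock (fun i => ¬p i) p = 0) :
    (A * B).toSquareBlockProp p = A.toSquareBlockProp p * B.toSquareBlockProp p := by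
  change (A * B).toBlock p p = A.toBlock p p * B.toBlock p p
  rw [Matrix.toBlock_mul_eq_add p p p A B, h, Matrix.mul_zero, add_zero]

/-- The identity matrix of the subset lattice in the "matrix of minors" normal form. [folklore] -/
private theorem one_eq_minor_one (X Y : Finset (Fin m)) :
    (1 : Matrix (Finset (Fin m)) (Finset (Fin m)) k) X Y = if h : X.card = Y.card then
      ((1 : Matrix (Fin m) (Fin m) k).submatrix (X.orderEmbOfFin rfl) (Y.orderEmbOfFin h.symm)).det
      else 0 := by
  classical
  by_cases h : X.card = Y.card
  · rw [dif_pos h]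
    change _ = Literature.LinearAlgebra.Matrix.compound X.card (1 : Matrix (Fin m) (Fin m) k)
      (Set.powersetCard.ofCard rfl) (Set.powersetCard.ofCard h.symm)
    rw [Literature.LinearAlgebra.Matrix.compound_one, Matrix.one_apply, Matrix.one_apply]
    simp only [Set.powersetCard.ofCard, Subtype.mk.injEq]
  · rw [dif_neg h, Matrix.one_apply, if_neg]
    rintro rfl
    exact h rfl

/-- **One generator.** For `γ = g ⊗ 1` (`g ∈ GL_m`), Prop. 2.16's matrix (transported along `e`)
satisfies `Ã(γ · y) = P Ã(y) Q⁻¹` with `Q = ⊕_{j<m} ∧^j gᵀ` (the block matrix of minors of `gᵀ` on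
the proper subsets) and `P = Q · diag(det g at ∅, 1 elsewhere)` (p0012:L40–L63: the lifts
`⊕_j ∧^j g`, the merged vertex `Λ^0E ≃ Λ^mE` carrying `det g` on the incoming side).
[cite: LandsbergRessayre2017, Prop. 2.16 (proof, p0012:L38–L63)] -/
private theorem exists_lift_generator (hm : 1 ≤ m) {n : ℕ} (e : HalfIdx m ≃ Fin n)
    (γ : GL (Fin m × Fin m) k) (g : GL (Fin m) k)
    (hγ : (γ : Matrix (Fin m × Fin m) (Fin m × Fin m) k) =
      (g : Matrix (Fin m) (Fin m) k) ⊗ₖ (1 : Matrix (Fin m) (Fin m) k)) :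
    ∃ P Q : GL (Fin n) k,
      Matrix.linSubstEntries γ (Matrix.reindex e e (detHalfMatrix k m)) =
        (P : Matrix (Fin n) (Fin n) k).map C * Matrix.reindex e e (detHalfMatrix k m) *
          ((Q⁻¹ : GL (Fin n) k) : Matrix (Fin n) (Fin n) k).map C := by
  classical
  -- `Gk = gᵀ` and its inverse
  set Gk : Matrix (Fin m) (Fin m) k := (g : Matrix (Fin m) (Fin m) k)ᵀ with hGk
  set Gk' : Matrix (Fin m) (Fin m) k := ((g⁻¹ : GL (Fin m) k) : Matrix (Fin m) (Fin m) k)ᵀ with hGk'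
  have hGG' : Gk * Gk' = 1 := by
    rw [hGk, hGk', ← Matrix.transpose_mul, ← Units.val_mul, inv_mul_cancel, Units.val_one,
      Matrix.transpose_one]
  have hG'G : Gk' * Gk = 1 := by
    rw [hGk, hGk', ← Matrix.transpose_mul, ← Units.val_mul, mul_inv_cancel, Units.val_one,
      Matrix.transpose_one]
  have hdet : Gk.det * Gk'.det = 1 := by rw [← Matrix.det_mul, hGG', Matrix.det_one]
  -- the block matrices of minors over `k`, mutually inverse (Cauchy–Binet)
  set MkG : Matrix (Finset (Fin m)) (Finset (Fin m)) k := Matrix.of fun X Y =>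
    if h : X.card = Y.card then (Gk.submatrix (X.orderEmbOfFin rfl) (Y.orderEmbOfFin h.symm)).det
    else 0 with hMkG
  set MkG' : Matrix (Finset (Fin m)) (Finset (Fin m)) k := Matrix.of fun X Y =>
    if h : X.card = Y.card then (Gk'.submatrix (X.orderEmbOfFin rfl) (Y.orderEmbOfFin h.symm)).det
    else 0 with hMkG'
  have hMM' : MkG * MkG' = 1 :=
    minor_mul_minor (G := Gk) (H := Gk') (MG := MkG) (MH := MkG') (MGH := 1) (fun _ _ => rfl)
      (fun _ _ => rfl) (fun X Y => by rw [hGG']; exact one_eq_minor_one X Y)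
  have hM'M : MkG' * MkG = 1 :=
    minor_mul_minor (G := Gk') (H := Gk) (MG := MkG') (MH := MkG) (MGH := 1) (fun _ _ => rfl)
      (fun _ _ => rfl) (fun X Y => by rw [hG'G]; exact one_eq_minor_one X Y)
  -- off-level vanishing against `univ`
  have hcardne : ∀ {T : Finset (Fin m)}, T ≠ univ → (univ : Finset (Fin m)).card ≠ T.card :=
    fun hT h => hT (Finset.eq_univ_of_card _ (by rw [← h, Finset.card_univ]))
  have hoffG : MkG.toBlock (fun S => ¬(S ≠ univ)) (fun S => S ≠ univ) = 0 := by
    ext ⟨T, hT⟩ ⟨S, hS⟩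
    rw [not_ne_iff] at hT
    subst hT
    rw [Matrix.toBlock_apply, Matrix.zero_apply, hMkG, Matrix.of_apply, dif_neg (hcardne hS)]
  have hoffG' : MkG'.toBlock (fun S => ¬(S ≠ univ)) (fun S => S ≠ univ) = 0 := by
    ext ⟨T, hT⟩ ⟨S, hS⟩
    rw [not_ne_iff] at hT
    subst hT
    rw [Matrix.toBlock_apply, Matrix.zero_apply, hMkG', Matrix.of_apply, dif_neg (hcardne hS)]
  -- the blocks `Q = ⊕_{j<m} ∧^j gᵀ` and `Q'`
  set Qk := MkG.toSquareBlockProp (fun S => S ≠ univ) with hQk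
  set Qk' := MkG'.toSquareBlockProp (fun S => S ≠ univ) with hQk'
  have hone : (1 : Matrix (Finset (Fin m)) (Finset (Fin m)) k).toSquareBlockProp (fun S => S ≠ univ) = 1 :=
    Matrix.toBlock_one_self _
  have hQQ' : Qk * Qk' = 1 := by
    rw [hQk, hQk', ← toSquareBlockProp_mul_of_lowerLeft _ _ _ hoffG', hMM', hone]
  have hQ'Q : Qk' * Qk = 1 := by
    rw [hQk, hQk', ← toSquareBlockProp_mul_of_lowerLeft _ _ _ hoffG, hM'M, hone]
  -- the diagonal `D = diag(det gᵀ at ∅, 1 elsewhere)` on the full lattice and on the block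
  set Dfull : Matrix (Finset (Fin m)) (Finset (Fin m)) k :=
    Matrix.diagonal fun S => if S = ∅ then Gk.det else 1 with hDfull
  set Dk : Matrix (HalfIdx m) (HalfIdx m) k :=
    Matrix.diagonal fun S => if S.1 = ∅ then Gk.det else 1 with hDk
  set Dk' : Matrix (HalfIdx m) (HalfIdx m) k :=
    Matrix.diagonal fun S => if S.1 = ∅ then Gk'.det else 1 with hDk'
  have hDblock : Dfull.toSquareBlockProp (fun S => S ≠ univ) = Dk := by
    rw [hDfull, hDk]
    exact Matrix.toBlock_diagonal_self _ _
  have hoffD : Dfull.toBlock (fun S => ¬(S ≠ univ)) (fun S => S ≠ univ) = 0 := by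
    ext ⟨T, hT⟩ ⟨S, hS⟩
    rw [not_ne_iff] at hT
    subst hT
    rw [Matrix.toBlock_apply, Matrix.zero_apply, hDfull, Matrix.diagonal_apply_ne _ (Ne.symm hS)]
  have hDD' : Dk * Dk' = 1 := by
    rw [hDk, hDk', Matrix.diagonal_mul_diagonal, ← Matrix.diagonal_one]
    congr 1
    funext S
    split_ifs <;> simp [hdet]
  have hD'D : Dk' * Dk = 1 := by
    rw [hDk, hDk', Matrix.diagonal_mul_diagonal, ← Matrix.diagonal_one]
    congr 1
    funext S
    split_ifs <;> simp [mul_comm Gk'.det, hdet]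
  -- the identity over the polynomial ring, on `HalfIdx m`
  have key : Matrix.linSubstEntries γ (detHalfMatrix k m) * Qk.map C =
      (Qk * Dk).map C * detHalfMatrix k m := by
    -- the same objects over the polynomial ring
    set GR : Matrix (Fin m) (Fin m) (MvPolynomial (Fin m × Fin m) k) :=
      Gk.map (C : k →+* MvPolynomial (Fin m × Fin m) k) with hGR
    set MR : Matrix (Finset (Fin m)) (Finset (Fin m)) (MvPolynomial (Fin m × Fin m) k) :=
      MkG.map (C : k →+* MvPolynomial (Fin m × Fin m) k) with hMR
    have hMRe : ∀ X Y, MR X Y = if h : X.card = Y.card then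
        (GR.submatrix (X.orderEmbOfFin rfl) (Y.orderEmbOfFin h.symm)).det else 0 := by
      intro X Y
      rw [hMR, Matrix.map_apply, hMkG, Matrix.of_apply]
      split_ifs with h
      · rw [hGR, RingHom.map_det, RingHom.mapMatrix_apply, Matrix.submatrix_map]
      · exact map_zero C
    set f : Fin m → ℕ → MvPolynomial (Fin m × Fin m) k := fun i c => Grenet.wt k m i c with hf
    set N : Matrix (Finset (Fin m)) (Finset (Fin m)) (MvPolynomial (Fin m × Fin m) k) :=
      Matrix.of fun U S => ∑ i, if i ∉ S ∧ U = insert i S then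
        (koszulSign S i : MvPolynomial (Fin m × Fin m) k) * f i S.card else 0 with hN
    set Ng : Matrix (Finset (Fin m)) (Finset (Fin m)) (MvPolynomial (Fin m × Fin m) k) :=
      Matrix.of fun U S => ∑ i, if i ∉ S ∧ U = insert i S then
        (koszulSign S i : MvPolynomial (Fin m × Fin m) k) * GR.mulVec (fun j => f j S.card) i else 0
      with hNg
    set E : Matrix (Finset (Fin m)) (Finset (Fin m)) (MvPolynomial (Fin m × Fin m) k) :=
      Matrix.of fun U S => if U = ∅ then (if S = univ then (1 : MvPolynomial (Fin m × Fin m) k) else 0)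
        else (if U = S then 1 else 0) with hE
    set DR : Matrix (Finset (Fin m)) (Finset (Fin m)) (MvPolynomial (Fin m × Fin m) k) :=
      Matrix.diagonal fun S => if S = ∅ then GR.det else 1 with hDR
    have h1 := arcs_mul_minor hMRe f (N := N) (Ng := Ng) (fun _ _ => rfl) (fun _ _ => rfl)
    have h2 := wrapRow_mul_minor hm hMRe (E := E) (D := DR) (fun _ _ => rfl) hDR
    have h4 := block_wrapArcs_mul_minor hMRe hDR (wrapArcs_mul_minor h1 h2)
    -- Prop. 2.16's matrix and its substituted version as blocks
    have hA : detHalfMatrix k m = (E * (1 + N)).toSquareBlockProp (fun S => S ≠ univ) :=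
      halfShape_eq_block (f := f) (fun T S => detHalfMatrix_apply' T S) (fun _ _ => rfl)
        (fun _ _ => rfl)
    have hAγ : Matrix.linSubstEntries γ (detHalfMatrix k m) =
        (E * (1 + Ng)).toSquareBlockProp (fun S => S ≠ univ) :=
      halfShape_eq_block (f := fun i c => GR.mulVec (fun j => f j c) i)
        (fun T S => linSubstEntries_detHalfMatrix_apply hγ T S) (fun _ _ => rfl) (fun _ _ => rfl)
    -- the blocks of `MR` and `MR DR`
    have hQR : MR.toSquareBlockProp (fun S => S ≠ univ) =
        Qk.map (C : k →+* MvPolynomial (Fin m × Fin m) k) := rfl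
    have hDRmap : DR = Dfull.map (C : k →+* MvPolynomial (Fin m × Fin m) k) := by
      rw [hDR, hDfull, Matrix.diagonal_map (map_zero _)]
      congr 1
      funext S
      split_ifs
      · rw [hGR, RingHom.map_det, RingHom.mapMatrix_apply]
      · rw [map_one]
    have hPD : (MR * DR).toSquareBlockProp (fun S => S ≠ univ) =
        (Qk * Dk).map (C : k →+* MvPolynomial (Fin m × Fin m) k) := by
      have hprod : MR * DR = (MkG * Dfull).map (C : k →+* MvPolynomial (Fin m × Fin m) k) := by
        rw [hMR, hDRmap, Matrix.map_mul]
      rw [hprod, ← hDblock, hQk, ← toSquareBlockProp_mul_of_lowerLeft _ _ _ hoffD]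
      rfl
    rw [hAγ, hA, ← hQR, ← hPD]
    exact h4
  -- units on `HalfIdx m`, then transported to `Fin n`
  have hrr : ∀ A B : Matrix (HalfIdx m) (HalfIdx m) k,
      Matrix.reindex e e A * Matrix.reindex e e B = Matrix.reindex e e (A * B) := fun A B =>
    Matrix.submatrix_mul_equiv A B e.symm e.symm e.symm
  have hr1 : Matrix.reindex e e (1 : Matrix (HalfIdx m) (HalfIdx m) k) = 1 := Matrix.submatrix_one_equiv _
  refine ⟨⟨Matrix.reindex e e (Qk * Dk), Matrix.reindex e e (Dk' * Qk'), ?_, ?_⟩,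
    ⟨Matrix.reindex e e Qk, Matrix.reindex e e Qk', ?_, ?_⟩, ?_⟩
  · rw [hrr, Matrix.mul_assoc, ← Matrix.mul_assoc Dk, hDD', Matrix.one_mul, hQQ', hr1]
  · rw [hrr, Matrix.mul_assoc, ← Matrix.mul_assoc Qk', hQ'Q, Matrix.one_mul, hD'D, hr1]
  · rw [hrr, hQQ', hr1]
  · rw [hrr, hQ'Q, hr1]
  · -- transport `key`
    change Matrix.reindex e e (Matrix.linSubstEntries γ (detHalfMatrix k m)) =
      (Matrix.reindex e e (Qk * Dk)).map C * Matrix.reindex e e (detHalfMatrix k m) *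
        (Matrix.reindex e e Qk').map C
    have key' : Matrix.linSubstEntries γ (detHalfMatrix k m) =
        (Qk * Dk).map C * detHalfMatrix k m * Qk'.map C := by
      rw [← key, Matrix.mul_assoc, ← Matrix.map_mul, hQQ', Matrix.map_one C (map_zero C) (map_one C),
        Matrix.mul_one]
    have hrrR : ∀ A B : Matrix (HalfIdx m) (HalfIdx m) (MvPolynomial (Fin m × Fin m) k),
        Matrix.reindex e e A * Matrix.reindex e e B = Matrix.reindex e e (A * B) := fun A B =>
      Matrix.submatrix_mul_equiv A B e.symm e.symm e.symm
    rw [key']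
    change _ = Matrix.reindex e e ((Qk * Dk).map C) * Matrix.reindex e e (detHalfMatrix k m) *
      Matrix.reindex e e (Qk'.map C)
    rw [hrrR, hrrR]






/-- **Prop. 2.16, second half: `Ã` RESPECTS `GL(E)`.** For every field `k`, `m ≥ 1` and every
indexing `e : HalfIdx m ≃ Fin n`, Prop. 2.16's matrix transported along `e` is an affine
determinantal representation of `detHalfSign m · det_m` with exact `GL_n × GL_n` lifts of all of
`leftLinearSubst k m` (generated by the `g ⊗ 1`, `g ∈ GL_m`): "Equation (3) shows that `GL(E)` is
contained in the image of `ρ̄_A`" (p0012:L62–L63). [cite: LandsbergRessayre2017, Prop. 2.16] -/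
theorem isEquivariantDetRepr_detHalfMatrix (hm : 1 ≤ m) {n : ℕ} (e : HalfIdx m ≃ Fin n) :
    IsEquivariantDetRepr (leftLinearSubst k m) (C ((detHalfSign m : ℤ) : k) * detPoly (Fin m) k)
      (Matrix.reindex e e (detHalfMatrix k m)) := by
  unfold leftLinearSubst
  refine IsEquivariantDetRepr.of_generators (isRegularDetRepr_detHalfMatrix k hm e).1 ?_
  rintro γ ⟨g, hγ⟩
  exact exists_lift_generator hm e γ g hγ

end Equivariance

end LR17

/-- **Discharge of the named fact `lr_prop_2_16`** (LR17 Prop. 2.16, p0007:L22–L40): for every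
`m ≥ 1` and every bijection `e : LR17.HalfIdx m ≃ Fin n`, `LR17.detHalfMatrix ℂ m` transported along
`e` is a regular affine determinantal representation of `detHalfSign m · det_m` that respects
`GL(E) = leftLinearSubst ℂ m`. [cite: LandsbergRessayre2017, Prop. 2.16] -/
theorem lr_prop_2_16_holds : lr_prop_2_16 := fun _ hm _ e =>
  ⟨LR17.isRegularDetRepr_detHalfMatrix ℂ hm e, LR17.isEquivariantDetRepr_detHalfMatrix hm e⟩

/-- **Thm. 2.14, "Moreover" half, unconditionally**: `srdc_{GL(E)}(det_m) ≤ 2^m - 1`, i.e. `det_m`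
has a regular `GL(E)`-equivariant determinantal representation of size `2^m - 1` (`m ≥ 1`)
(p0006:L138–L139, from Prop. 2.16 via the companion file's `lr_thm_2_14_le`).
[cite: LandsbergRessayre2017, Thm. 2.14] -/
theorem LR17.hasRegularEquivariantDetRepr_detPoly {m : ℕ} (hm : 1 ≤ m) :
    HasRegularEquivariantDetRepr (leftLinearSubst ℂ m) (detPoly (Fin m) ℂ) (2 ^ m - 1) :=
  lr_thm_2_14_le lr_prop_2_16_holds hm

/-- **Thm. 2.14 as an equality, modulo the lower bound only**: given the named fact `lr_thm_2_14_ge`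
(the representation-theoretic lower bound, §4.1), `srdc_{GL(E)}(det_m) = 2^m - 1` for `m ≥ 1`
(p0006:L135–L142). [cite: LandsbergRessayre2017, Thm. 2.14] -/
theorem LR17.regularEquivariantDetComplexity_detPoly_eq (hge : lr_thm_2_14_ge) {m : ℕ} (hm : 1 ≤ m) :
    regularEquivariantDetComplexity (leftLinearSubst ℂ m) (detPoly (Fin m) ℂ) = 2 ^ m - 1 :=
  lr_thm_2_14_eq lr_prop_2_16_holds hge hm

end Literature.Computability.AlgebraicComplexity
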